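import Summits.ABC.ABC.Theorems.TwistAmplificationSharpModerateLawDefs

/-!
# Lattice half of `SharpModerateLaw`, support file 1/4: primitive lattice points in a parallelogram

Kane's Lemma 4 (arXiv:1104.2635) for `ℤ²` and its congruence sublattices, elementary and with
explicit constants (the geometry-of-numbers input of `stub_latticeHalf`, crux stmt-ABC-1975, line
`syzygy-lattice-half-deep-few-primes`):

* `prim_count` — the primitive `z ∈ ℤ²` with `|a z₁ + b z₂| ≤ 1`, `|c z₁ + d z₂| ≤ 1` are finitely
  many, at most `16/|ad − bc| + 2` (if two of them are independent the parallelogram contains a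
  basis of `ℤ²` — `exists_basis` — and one slices: `card_pn_le`);
* `lattice_prim_count` / `latticeGeometry_main` — inside the lattice `{q : M ∣ det(q₀, q)}`
  (`q₀` primitive, index `M`): at most `16 r₁ r₂ /(M |ad − bc|) + 2`.
-/

noncomputable section

namespace Summit.ABC.ABC.Theorems.SharpModerateLaw

open Finset
/-! ## Primitive points of `ℤ²` in a parallelogram -/

/-- `det(x, y)` of two integer vectors. -/
def dt (x y : ℤ × ℤ) : ℤ := x.1 * y.2 - x.2 * y.1

/-- The gauge `max(|a u + b v|, |c u + d v|)` of the parallelogram with rows `(a,b)`, `(c,d)`. -/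
def pn (a b c d : ℝ) (z : ℤ × ℤ) : ℝ := max |a * z.1 + b * z.2| |c * z.1 + d * z.2|

/-- Slicing count: if all entries are `≤ 1` in absolute value and `|d| ≤ |b|`, the integer points of
the unit gauge ball are finitely many, at most `16/|ad − bc| + 1`. -/
theorem card_pn_le_aux {a b c d : ℝ} (ha1 : |a| ≤ 1) (hb1 : |b| ≤ 1) (hc1 : |c| ≤ 1)
    (hdb : |d| ≤ |b|) (hδ : a * d - b * c ≠ 0) :
    {z : ℤ × ℤ | pn a b c d z ≤ 1}.Finite ∧
      (({z : ℤ × ℤ | pn a b c d z ≤ 1}.ncard : ℕ) : ℝ) ≤ 16 / |a * d - b * c| + 1 := by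
  classical
  have toNat_cast_le : ∀ {k : ℤ} {x : ℝ}, (k : ℝ) ≤ x → 0 ≤ x → ((k.toNat : ℕ) : ℝ) ≤ x := by
    intro k x hk hx
    have : ((k.toNat : ℕ) : ℝ) = ((k.toNat : ℤ) : ℝ) := rfl
    rw [this, Int.toNat_eq_max]; push_cast; exact max_le hk hx
  set δ := a * d - b * c with hδdef
  have hΔ : 0 < |δ| := abs_pos.mpr hδ
  have hb : b ≠ 0 := by
    rintro rfl
    have : d = 0 := abs_nonpos_iff.mp (by simpa using hdb)
    exact hδ (by simp [hδdef, this])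
  have hβ : 0 < |b| := abs_pos.mpr hb
  have hδle : |δ| ≤ 2 * |b| := by
    calc |δ| ≤ |a * d| + |b * c| := abs_sub _ _
      _ = |a| * |d| + |b| * |c| := by rw [abs_mul, abs_mul]
      _ ≤ 1 * |d| + |b| * 1 := by gcongr
      _ ≤ 2 * |b| := by linarith
  set R : ℝ := 2 * |b| / |δ| with hR
  have hR0 : 0 ≤ R := by positivity
  let lo : ℤ → ℝ := fun z1 => -a * z1 / b - 1 / |b|
  let hi : ℤ → ℝ := fun z1 => -a * z1 / b + 1 / |b|
  let I1 : Finset ℤ := Icc (-⌊R⌋) ⌊R⌋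
  let U : Finset (ℤ × ℤ) := I1.biUnion fun z1 => (Icc ⌈lo z1⌉ ⌊hi z1⌋).image fun z2 => (z1, z2)
  have hsub : {z : ℤ × ℤ | pn a b c d z ≤ 1} ⊆ ↑U := by
    intro z hz
    simp only [Set.mem_setOf_eq, pn, max_le_iff] at hz
    obtain ⟨h1, h2⟩ := hz
    have hz1 : |(z.1 : ℝ)| ≤ R := by
      have key : δ * z.1 = d * (a * z.1 + b * z.2) - b * (c * z.1 + d * z.2) := by
        simp only [hδdef]; ring
      have : |δ| * |(z.1 : ℝ)| ≤ 2 * |b| := by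
        rw [← abs_mul, key]
        calc |d * (a * z.1 + b * z.2) - b * (c * z.1 + d * z.2)|
            ≤ |d * (a * z.1 + b * z.2)| + |b * (c * z.1 + d * z.2)| := abs_sub _ _
          _ = |d| * |a * z.1 + b * z.2| + |b| * |c * z.1 + d * z.2| := by rw [abs_mul, abs_mul]
          _ ≤ |b| * 1 + |b| * 1 := by gcongr
          _ = 2 * |b| := by ring
      rw [hR, le_div_iff₀ hΔ]; linarith
    have hz2 : |(z.2 : ℝ) - (-a * z.1 / b)| ≤ 1 / |b| := by
      have : (z.2 : ℝ) - (-a * z.1 / b) = (a * z.1 + b * z.2) / b := by field_simp; ring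
      rw [this, abs_div, div_le_div_iff_of_pos_right hβ]; exact h1
    rw [abs_sub_le_iff] at hz2
    rw [abs_le] at hz1
    simp only [coe_biUnion, coe_image, coe_Icc, Set.mem_iUnion, Set.mem_image, Set.mem_Icc, U, I1]
    refine ⟨z.1, ⟨?_, Int.le_floor.mpr hz1.2⟩, z.2, ⟨Int.ceil_le.mpr ?_, Int.le_floor.mpr ?_⟩, rfl⟩
    · rw [neg_le, Int.le_floor]; push_cast; linarith
    · show lo z.1 ≤ _
      simp only [lo]; linarith
    · show _ ≤ hi z.1
      simp only [hi]; linarith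
  refine ⟨(U.finite_toSet).subset hsub, ?_⟩
  have hslice : ∀ z1 : ℤ, ((Icc ⌈lo z1⌉ ⌊hi z1⌋).card : ℝ) ≤ 2 / |b| + 1 := by
    intro z1
    rw [Int.card_Icc]
    refine toNat_cast_le ?_ (by positivity)
    push_cast
    have e1 := Int.floor_le (hi z1)
    have e2 := Int.le_ceil (lo z1)
    have : hi z1 - lo z1 = 2 / |b| := by simp only [hi, lo]; ring
    linarith
  have hI1 : ((I1.card : ℕ) : ℝ) ≤ 2 * R + 1 := by
    simp only [I1, Int.card_Icc]
    refine toNat_cast_le ?_ (by positivity)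
    push_cast
    have := Int.floor_le R
    linarith
  calc (({z : ℤ × ℤ | pn a b c d z ≤ 1}.ncard : ℕ) : ℝ) ≤ U.card := by
        exact_mod_cast Set.ncard_le_ncard hsub U.finite_toSet |>.trans (by rw [Set.ncard_coe_finset])
    _ ≤ ∑ z1 ∈ I1, (((Icc ⌈lo z1⌉ ⌊hi z1⌋).image fun z2 => (z1, z2)).card : ℝ) := by
        exact_mod_cast card_biUnion_le
    _ ≤ ∑ _z1 ∈ I1, (2 / |b| + 1 : ℝ) := by
        gcongr with z1
        exact le_trans (by exact_mod_cast card_image_le) (hslice z1)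
    _ = I1.card * (2 / |b| + 1) := by rw [sum_const, nsmul_eq_mul]
    _ ≤ (2 * R + 1) * (2 / |b| + 1) := by gcongr
    _ = 8 / |δ| + 4 * |b| / |δ| + 2 / |b| + 1 := by
        simp only [hR]; field_simp; ring
    _ ≤ 8 / |δ| + 4 / |δ| + 4 / |δ| + 1 := by
        gcongr ?_ + ?_ + ?_ + 1
        · exact le_rfl
        · exact div_le_div_of_nonneg_right (by linarith) hΔ.le
        · rw [div_le_div_iff₀ hβ hΔ]; linarith
    _ = 16 / |δ| + 1 := by ring

/-- Slicing count without the normalisation `|d| ≤ |b|` (swap the two rows otherwise). -/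
theorem card_pn_le {a b c d : ℝ} (ha1 : |a| ≤ 1) (hb1 : |b| ≤ 1) (hc1 : |c| ≤ 1) (hd1 : |d| ≤ 1)
    (hδ : a * d - b * c ≠ 0) :
    {z : ℤ × ℤ | pn a b c d z ≤ 1}.Finite ∧
      (({z : ℤ × ℤ | pn a b c d z ≤ 1}.ncard : ℕ) : ℝ) ≤ 16 / |a * d - b * c| + 1 := by
  rcases le_total |d| |b| with h | h
  · exact card_pn_le_aux ha1 hb1 hc1 h hδ
  · have hδ' : c * b - d * a ≠ 0 := by intro h'; exact hδ (by linarith)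
    have hset : {z : ℤ × ℤ | pn a b c d z ≤ 1} = {z : ℤ × ℤ | pn c d a b z ≤ 1} := by
      ext z; simp only [Set.mem_setOf_eq, pn, max_comm]
    have habs : |c * b - d * a| = |a * d - b * c| := by
      rw [← abs_neg]; congr 1; ring
    obtain ⟨h1, h2⟩ := card_pn_le_aux hc1 hd1 ha1 h hδ'
    rw [hset, ← habs]; exact ⟨h1, h2⟩

/-- Rows scale: for `z = g • (m, n)` with `g ≥ 1`, `|a m + b n| ≤ |a z₁ + b z₂|`. -/
theorem row_prim {a b : ℝ} {z : ℤ × ℤ} {m n g : ℤ} (hm : z.1 = m * g) (hn : z.2 = n * g)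
    (hg : 1 ≤ g) : |a * m + b * n| ≤ |a * z.1 + b * z.2| := by
  have hg' : (1 : ℝ) ≤ g := by exact_mod_cast hg
  have : a * z.1 + b * z.2 = (a * m + b * n) * g := by rw [hm, hn]; push_cast; ring
  rw [this, abs_mul, abs_of_pos (by linarith : (0 : ℝ) < g)]
  exact le_mul_of_one_le_right (abs_nonneg _) hg'

/-- Row estimate for the second basis vector `f = w₀ + s e`, where `β' w₀ = z' − cc e`. -/
theorem row_le_one {a b : ℝ} {e z' w₀ : ℤ × ℤ} {cc β' s : ℤ} (hβ' : β' ≠ 0)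
    (hw1 : β' * w₀.1 = z'.1 - cc * e.1) (hw2 : β' * w₀.2 = z'.2 - cc * e.2)
    (hs : |(s : ℝ) - cc / β'| ≤ 1 - 1 / |(β' : ℝ)|)
    (hz' : |a * z'.1 + b * z'.2| ≤ 1) (he : |a * e.1 + b * e.2| ≤ 1) :
    |a * (w₀.1 + s * e.1) + b * (w₀.2 + s * e.2)| ≤ 1 := by
  have hβr : (β' : ℝ) ≠ 0 := by exact_mod_cast hβ'
  have hw1' : (w₀.1 : ℝ) = (z'.1 - cc * e.1) / β' := by
    rw [eq_div_iff hβr]; exact_mod_cast (by rw [mul_comm]; exact hw1)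
  have hw2' : (w₀.2 : ℝ) = (z'.2 - cc * e.2) / β' := by
    rw [eq_div_iff hβr]; exact_mod_cast (by rw [mul_comm]; exact hw2)
  have key : a * (w₀.1 + s * e.1) + b * (w₀.2 + s * e.2) =
      (1 / β') * (a * z'.1 + b * z'.2) + (s - cc / β') * (a * e.1 + b * e.2) := by
    rw [hw1', hw2']; field_simp; ring
  rw [key]
  calc |(1 / β') * (a * z'.1 + b * z'.2) + (s - cc / β') * (a * e.1 + b * e.2)|
      ≤ |(1 / β') * (a * z'.1 + b * z'.2)| + |(s - cc / β') * (a * e.1 + b * e.2)| := abs_add_le _ _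
    _ = 1 / |(β' : ℝ)| * |a * z'.1 + b * z'.2| + |(s : ℝ) - cc / β'| * |a * e.1 + b * e.2| := by
        rw [abs_mul, abs_mul, abs_div, abs_one]
    _ ≤ 1 / |(β' : ℝ)| * 1 + (1 - 1 / |(β' : ℝ)|) * 1 := by
        gcongr
        · exact le_trans (abs_nonneg _) hs
    _ = 1 := by ring

/-- **A basis inside the gauge ball.** If the unit ball of the gauge contains two independent
integer vectors, it contains a basis `(e, f)` of `ℤ²` (`det(e, f) = 1`). -/
theorem exists_basis {a b c d : ℝ} {z z' : ℤ × ℤ} (hz : pn a b c d z ≤ 1)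
    (hz' : pn a b c d z' ≤ 1) (hind : dt z z' ≠ 0) :
    ∃ e f : ℤ × ℤ, dt e f = 1 ∧ pn a b c d e ≤ 1 ∧ pn a b c d f ≤ 1 := by
  simp only [pn, max_le_iff] at hz hz' ⊢
  have hg : 0 < Int.gcd z.1 z.2 := by
    refine Int.gcd_pos_iff.mpr ?_
    by_contra h; push Not at h
    exact hind (by simp [dt, h.1, h.2])
  obtain ⟨m, n, hmn, hm, hn⟩ := Int.exists_gcd_one hg
  set g : ℤ := (Int.gcd z.1 z.2 : ℤ) with hgdef
  have hg1 : (1 : ℤ) ≤ g := by simp only [hgdef]; exact_mod_cast hg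
  obtain ⟨α, β, hαβ⟩ := Int.isCoprime_iff_gcd_eq_one.mpr hmn
  -- `e = (m, n)`, `w₀ = (-β, α)`, `det(e, w₀) = 1`
  set β' : ℤ := m * z'.2 - n * z'.1 with hβ'def
  have hβ' : β' ≠ 0 := by
    intro h0
    apply hind
    simp only [dt, hm, hn]
    linear_combination g * h0
  set cc : ℤ := z'.1 * α + z'.2 * β with hccdef
  set s : ℤ := round ((cc : ℝ) / β') with hsdef
  have he1 : |a * m + b * n| ≤ 1 := (row_prim hm hn hg1).trans hz.1
  have he2 : |c * m + d * n| ≤ 1 := (row_prim hm hn hg1).trans hz.2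
  refine ⟨(m, n), (-β + s * m, α + s * n), ?_, ⟨he1, he2⟩, ?_⟩
  · simp only [dt]; linear_combination hαβ
  · have hw1 : β' * (-β) = z'.1 - cc * m := by
      simp only [hβ'def, hccdef]; linear_combination z'.1 * hαβ
    have hw2 : β' * α = z'.2 - cc * n := by
      simp only [hβ'def, hccdef]; linear_combination z'.2 * hαβ
    have hs : |(s : ℝ) - cc / β'| ≤ 1 - 1 / |(β' : ℝ)| := by
      rcases eq_or_lt_of_le (Int.one_le_abs hβ') with h1 | h2
      · -- `β' = ±1`: `cc/β'` is an integer and `s` is that integer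
        have hq : ∃ k : ℤ, (cc : ℝ) / β' = k := by
          rcases abs_eq (zero_le_one' ℤ) |>.mp h1.symm with h | h
          · exact ⟨cc, by rw [h]; simp⟩
          · exact ⟨-cc, by rw [h]; push_cast; field_simp⟩
        obtain ⟨k, hk⟩ := hq
        have hsk : s = k := by rw [hsdef, hk, round_intCast]
        have : |(β' : ℝ)| = 1 := by exact_mod_cast h1.symm
        rw [hsk, hk, this]; simp
      · have h2' : (2 : ℝ) ≤ |(β' : ℝ)| := by exact_mod_cast h2
        have hr : |(s : ℝ) - cc / β'| ≤ 1 / 2 := by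
          rw [abs_sub_comm, hsdef]; exact abs_sub_round _
        have : 1 / |(β' : ℝ)| ≤ 1 / 2 := by
          rw [div_le_div_iff₀ (by linarith) (by norm_num)]; linarith
        linarith
    constructor
    · have := row_le_one (e := (m, n)) (z' := z') (w₀ := (-β, α)) hβ' hw1 hw2 hs hz'.1 he1
      simpa using this
    · have := row_le_one (e := (m, n)) (z' := z') (w₀ := (-β, α)) hβ' hw1 hw2 hs hz'.2 he2
      simpa using this

/-- Two primitive vectors with `det = 0` are equal up to sign. -/
theorem eq_or_eq_neg_of_dt {e z : ℤ × ℤ} (he : Int.gcd e.1 e.2 = 1) (hz : Int.gcd z.1 z.2 = 1)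
    (h : dt e z = 0) : z = e ∨ z = -e := by
  obtain ⟨α, β, hαβ⟩ := Int.isCoprime_iff_gcd_eq_one.mpr he
  set l : ℤ := α * z.1 + β * z.2 with hl
  simp only [dt] at h
  have h1 : z.1 = l * e.1 := by simp only [hl]; linear_combination (-z.1) * hαβ - β * h
  have h2 : z.2 = l * e.2 := by simp only [hl]; linear_combination (-z.2) * hαβ + α * h
  have hlabs : l.natAbs = 1 := by
    have := hz; rw [h1, h2, Int.gcd_mul_left, he, mul_one] at this; exact this
  rcases Int.natAbs_eq_iff.mp hlabs with hl1 | hl1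
  · left; ext <;> simp [h1, h2, hl1]
  · right; ext <;> simp [h1, h2, hl1]

/-- **Primitive points of `ℤ²` in a parallelogram** (Kane's Lemma 4 for `ℤ²`): the primitive
integer vectors `z` with `|a z₁ + b z₂| ≤ 1` and `|c z₁ + d z₂| ≤ 1` are finitely many, at most
`16/|ad − bc| + 2`. -/
theorem prim_count {a b c d : ℝ} (hδ : a * d - b * c ≠ 0) :
    {z : ℤ × ℤ | Int.gcd z.1 z.2 = 1 ∧ pn a b c d z ≤ 1}.Finite ∧
      (({z : ℤ × ℤ | Int.gcd z.1 z.2 = 1 ∧ pn a b c d z ≤ 1}.ncard : ℕ) : ℝ) ≤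
        16 / |a * d - b * c| + 2 := by
  set S := {z : ℤ × ℤ | Int.gcd z.1 z.2 = 1 ∧ pn a b c d z ≤ 1} with hS
  have hΔ : 0 < |a * d - b * c| := abs_pos.mpr hδ
  by_cases hex : ∃ z ∈ S, ∃ z' ∈ S, dt z z' ≠ 0
  · obtain ⟨z, hz, z', hz', hind⟩ := hex
    obtain ⟨e, f, hef, he, hf⟩ := exists_basis hz.2 hz'.2 hind
    simp only [pn, max_le_iff] at he hf
    -- new coefficients: the columns `e`, `f`
    set a' := a * e.1 + b * e.2
    set b' := a * f.1 + b * f.2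
    set c' := c * e.1 + d * e.2
    set d' := c * f.1 + d * f.2
    have hδ' : a' * d' - b' * c' = a * d - b * c := by
      have : ((dt e f : ℤ) : ℝ) = 1 := by exact_mod_cast hef
      simp only [dt] at this; push_cast at this
      simp only [a', b', c', d']; linear_combination (a * d - b * c) * this
    have habs : ∀ x : ℝ, |x| ≤ 1 ↔ |x| ≤ 1 := fun x => Iff.rfl
    obtain ⟨hTfin, hTcard⟩ := card_pn_le (abs_le.mpr (abs_le.mp he.1)) (abs_le.mpr (abs_le.mp hf.1))
      (abs_le.mpr (abs_le.mp he.2)) (abs_le.mpr (abs_le.mp hf.2)) (hδ'.symm ▸ hδ)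
    -- the coordinate map `z ↦ (det(z, f), det(e, z))`
    let φ : ℤ × ℤ → ℤ × ℤ := fun z => (dt z f, dt e z)
    have hrepr : ∀ z : ℤ × ℤ, z = ((φ z).1 * e.1 + (φ z).2 * f.1, (φ z).1 * e.2 + (φ z).2 * f.2) := by
      intro z; simp only [φ, dt] at hef ⊢
      ext
      · linear_combination (-z.1) * hef
      · linear_combination (-z.2) * hef
    have hmaps : ∀ z ∈ S, φ z ∈ {x : ℤ × ℤ | pn a' b' c' d' x ≤ 1} := by
      intro z hz
      have h := hz.2
      simp only [Set.mem_setOf_eq, pn, max_le_iff] at h ⊢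
      have e1 : a' * (φ z).1 + b' * (φ z).2 = a * z.1 + b * z.2 := by
        conv_rhs => rw [hrepr z]
        simp only [a', b']; push_cast; ring
      have e2 : c' * (φ z).1 + d' * (φ z).2 = c * z.1 + d * z.2 := by
        conv_rhs => rw [hrepr z]
        simp only [c', d']; push_cast; ring
      rw [e1, e2]; exact h
    have hinj : Set.InjOn φ S := by
      intro z _ w _ hzw
      rw [hrepr z, hrepr w, hzw]
    refine ⟨Set.Finite.of_injOn hmaps hinj hTfin, ?_⟩
    calc ((S.ncard : ℕ) : ℝ) ≤ ({x : ℤ × ℤ | pn a' b' c' d' x ≤ 1}.ncard : ℕ) := by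
          exact_mod_cast Set.ncard_le_ncard_of_injOn φ hmaps hinj hTfin
      _ ≤ 16 / |a' * d' - b' * c'| + 1 := hTcard
      _ ≤ 16 / |a * d - b * c| + 2 := by rw [hδ']; linarith
  · push Not at hex
    by_cases hne : S = ∅
    · rw [hne]; simp; positivity
    · obtain ⟨e, he⟩ := Set.nonempty_iff_ne_empty.mpr hne
      have hsub : S ⊆ {e, -e} := by
        intro z hz
        rcases eq_or_eq_neg_of_dt he.1 hz.1 (hex e he z hz) with h | h
        · exact h ▸ Set.mem_insert _ _
        · exact h ▸ Set.mem_insert_of_mem _ rfl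
      have hfin : ({e, -e} : Set (ℤ × ℤ)).Finite := Set.toFinite _
      refine ⟨hfin.subset hsub, ?_⟩
      calc ((S.ncard : ℕ) : ℝ) ≤ (({e, -e} : Set (ℤ × ℤ)).ncard : ℕ) := by
            exact_mod_cast Set.ncard_le_ncard hsub hfin
        _ ≤ 2 := by
            exact_mod_cast (Set.ncard_insert_le _ _).trans (by simp)
        _ ≤ 16 / |a * d - b * c| + 2 := by linarith [div_nonneg (by norm_num : (0:ℝ) ≤ 16) hΔ.le]

/-- **Primitive points of a congruence lattice in a parallelogram.** For `q₀` primitive and `M ≥ 1`,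
the primitive `q` with `M ∣ det(q₀, q)`, `|a q₁ + b q₂| ≤ r₁`, `|c q₁ + d q₂| ≤ r₂` are finitely many,
at most `16 r₁ r₂ / (M |ad − bc|) + 2`. -/
theorem lattice_prim_count {a b c d r₁ r₂ : ℝ} (hδ : a * d - b * c ≠ 0) (hr₁ : 0 < r₁)
    (hr₂ : 0 < r₂) {q₀ : ℤ × ℤ} (hq₀ : Int.gcd q₀.1 q₀.2 = 1) {M : ℕ} (hM : 0 < M) :
    {q : ℤ × ℤ | Int.gcd q.1 q.2 = 1 ∧ (M : ℤ) ∣ dt q₀ q ∧ |a * q.1 + b * q.2| ≤ r₁ ∧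
        |c * q.1 + d * q.2| ≤ r₂}.Finite ∧
      (({q : ℤ × ℤ | Int.gcd q.1 q.2 = 1 ∧ (M : ℤ) ∣ dt q₀ q ∧ |a * q.1 + b * q.2| ≤ r₁ ∧
        |c * q.1 + d * q.2| ≤ r₂}.ncard : ℕ) : ℝ) ≤ 16 * r₁ * r₂ / (M * |a * d - b * c|) + 2 := by
  set S := {q : ℤ × ℤ | Int.gcd q.1 q.2 = 1 ∧ (M : ℤ) ∣ dt q₀ q ∧ |a * q.1 + b * q.2| ≤ r₁ ∧
        |c * q.1 + d * q.2| ≤ r₂}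
  obtain ⟨α, β, hαβ⟩ := Int.isCoprime_iff_gcd_eq_one.mpr hq₀
  -- `w₀ = (-β, α)`, `det(q₀, w₀) = 1`; new gauge
  set A : ℝ := (a * q₀.1 + b * q₀.2) / r₁
  set B : ℝ := M * (a * (-β) + b * α) / r₁
  set C : ℝ := (c * q₀.1 + d * q₀.2) / r₂
  set D : ℝ := M * (c * (-β) + d * α) / r₂
  have hMr : (0 : ℝ) < M := by exact_mod_cast hM
  have hδ' : A * D - B * C = M * (a * d - b * c) / (r₁ * r₂) := by
    have h1 : ((q₀.1 * α - q₀.2 * (-β) : ℤ) : ℝ) = 1 := by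
      exact_mod_cast (by linear_combination hαβ : q₀.1 * α - q₀.2 * (-β) = 1)
    push_cast at h1
    simp only [A, B, C, D]
    rw [div_mul_div_comm, div_mul_div_comm, ← sub_div]
    congr 1
    linear_combination (M : ℝ) * (a * d - b * c) * h1
  have hδ'0 : A * D - B * C ≠ 0 := by rw [hδ']; positivity
  obtain ⟨hTfin, hTcard⟩ := prim_count hδ'0
  let ψ : ℤ × ℤ → ℤ × ℤ := fun q => (dt q (-β, α), dt q₀ q / M)
  have hrepr : ∀ q ∈ S, q = ((ψ q).1 * q₀.1 + (M * (ψ q).2) * (-β),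
      (ψ q).1 * q₀.2 + (M * (ψ q).2) * α) := by
    intro q hq
    have hd : (M : ℤ) * (dt q₀ q / M) = dt q₀ q := Int.mul_ediv_cancel' hq.2.1
    simp only [ψ]
    rw [hd]
    simp only [dt]
    ext
    · linear_combination (-q.1) * hαβ
    · linear_combination (-q.2) * hαβ
  have hmaps : ∀ q ∈ S, ψ q ∈ {z : ℤ × ℤ | Int.gcd z.1 z.2 = 1 ∧ pn A B C D z ≤ 1} := by
    intro q hq
    have hq' := hrepr q hq
    refine ⟨?_, ?_⟩
    · refine Int.gcd_eq_one_iff.mpr fun k h1 h2 => ?_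
      have := Int.gcd_eq_one_iff.mp hq.1 k
      refine this ?_ ?_
      · rw [hq']; exact dvd_add (dvd_mul_of_dvd_left h1 _) (dvd_mul_of_dvd_left (dvd_mul_of_dvd_right h2 _) _)
      · rw [hq']; exact dvd_add (dvd_mul_of_dvd_left h1 _) (dvd_mul_of_dvd_left (dvd_mul_of_dvd_right h2 _) _)
    · simp only [pn, max_le_iff]
      obtain ⟨-, -, h3, h4⟩ := hq
      have e1 : A * (ψ q).1 + B * (ψ q).2 = (a * q.1 + b * q.2) / r₁ := by
        conv_rhs => rw [hq']
        simp only [A, B]; rw [div_mul_eq_mul_div, div_mul_eq_mul_div, ← add_div]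
        congr 1; push_cast; ring
      have e2 : C * (ψ q).1 + D * (ψ q).2 = (c * q.1 + d * q.2) / r₂ := by
        conv_rhs => rw [hq']
        simp only [C, D]; rw [div_mul_eq_mul_div, div_mul_eq_mul_div, ← add_div]
        congr 1; push_cast; ring
      rw [e1, e2, abs_div, abs_div, abs_of_pos hr₁, abs_of_pos hr₂, div_le_one hr₁, div_le_one hr₂]
      exact ⟨h3, h4⟩
  have hinj : Set.InjOn ψ S := by
    intro z hz w hw hzw
    rw [hrepr z hz, hrepr w hw, hzw]
  refine ⟨Set.Finite.of_injOn hmaps hinj hTfin, ?_⟩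
  calc ((S.ncard : ℕ) : ℝ) ≤ ({z : ℤ × ℤ | Int.gcd z.1 z.2 = 1 ∧ pn A B C D z ≤ 1}.ncard : ℕ) := by
        exact_mod_cast Set.ncard_le_ncard_of_injOn ψ hmaps hinj hTfin
    _ ≤ 16 / |A * D - B * C| + 2 := hTcard
    _ = 16 * r₁ * r₂ / (M * |a * d - b * c|) + 2 := by
        rw [hδ', abs_div, abs_mul, abs_of_pos hMr, abs_of_pos (mul_pos hr₁ hr₂)]
        field_simp

/-- **Registered export** (support file 1/4 of `stub_latticeHalf`): primitive points of the lattice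
`{q : M ∣ det(q₀, q)}` in the parallelogram `{|a q₁ + b q₂| ≤ r₁, |c q₁ + d q₂| ≤ r₂}` number at most
`16 r₁ r₂ / (M |ad − bc|) + 2`. -/
theorem latticeGeometry_main : ∀ (a b c d r₁ r₂ : ℝ), a * d - b * c ≠ 0 → 0 < r₁ → 0 < r₂ → ∀ (q₀ : ℤ × ℤ), Int.gcd q₀.1 q₀.2 = 1 → ∀ (M : ℕ), 0 < M → (({q : ℤ × ℤ | Int.gcd q.1 q.2 = 1 ∧ (M : ℤ) ∣ dt q₀ q ∧ |a * q.1 + b * q.2| ≤ r₁ ∧ |c * q.1 + d * q.2| ≤ r₂}.ncard : ℕ) : ℝ) ≤ 16 * r₁ * r₂ / (M * |a * d - b * c|) + 2 :=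
  fun _ _ _ _ _ _ hδ hr₁ hr₂ _ hq₀ _ hM => (lattice_prim_count hδ hr₁ hr₂ hq₀ hM).2

end Summit.ABC.ABC.Theorems.SharpModerateLaw

end
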